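import Summits.BirchSwinnertonDyer.BirchSwinnertonDyer.Theorems.ByReductionTypeAtTwoSupersingularFlatBlindTwistedOnto
import Summits.BirchSwinnertonDyer.BirchSwinnertonDyer.Theorems.ByReductionTypeAtTwoSupersingularFlatBlindTwistedCount
import Summits.BirchSwinnertonDyer.BirchSwinnertonDyer.Theorems.ThetaPartnerAtTwoSignedControlAtTwoCorankGrowth
import Summits.BirchSwinnertonDyer.Rank1Residual.Additive.ClassicalConditionAwayBadPlaces
import Literature.NumberTheory.EllipticCurves.GoodReductionUnramifiedProofs
import Literature.NumberTheory.GaloisRepresentations.DecompositionGroupOfCompletion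
import HarnessLib

/-!
# Route `ByReductionTypeAtTwo` (rung K4), crux `SupersingularRankZeroAtTwo` (item stmt-BirchSwinnertonDyer-19097), line
# `odd_blind_package` v2.6.1 slot 5 (CDF_glob `OddBlindPackage.FlatBlindControlOfLocalAtTwo`), hand h2 = HT-3, part 2 of 2:
# **THE LIFT** — a uniform bound on the level-`J` ♭-twisted Selmer groups `H¹_{𝓕♭_J,S₀}(ℚ, E[2^J](ψ₂))` makes `Sel♭(E/ℚ_∞)[γ+1]`
# FINITE (`HT3_finite_endInvariants_of_uniform_bound`, signature VERBATIM from the LEAD's lean-checked scratch)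
# (cell `bsd-2adic`, seat `t42` GEN 38; LEAD ss-1 GEN 19 `HOME/ss/gen19/HAND-TARGETS-CDFglob.md` §2 h2, pen SUMMON 20260831T042325Z,
# director-bsd (748))

HONEST FRAMING: THEOREMS ONLY (no definition, no named fact, no `sorry`, no instance); the converse direction of BRICK 1
(`exists_addMonoidHom_flatTwistedInfRes_two`) plus the count; a helper (`--supports stmt-BirchSwinnertonDyer-19097`): it does NOT prove
CDF_glob, CDF±, CDC or the crux; nothing booked; BSD is proved for no curve by any of this. bears_on: K4 (19097). Part 1
(`…FlatBlindTwistedOnto.lean`): the onto-ness `exists_twistedTorsionToH1_eq_of_zsmul_conjH1_eq`.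

## What is proved

§2 (any number field `K : Type`, any `p`, any unit twist, any `ℤ_p`-extension `κ`; Sprung's data `(ap, g, c, •)` at a place `v ∋ p`,
`v ∉ S₀`, good reduction outside `S₀ ∪ {v ∣ p}`). **The local conditions of the lift** (`mem_selmerGroup_sharpFlat_of_twistedTorsionToH1_mem`):
if `twistedTorsionToH1 x ∈ Sel^•(E/K_∞)` (Def. 7.11) then `x ∈ H¹_{𝓕^•_J,S₀}(K, E[p^J](χ_u))` (`twistedSharpFlatSelmerStructure`):
•-condition at `v` by the (D) bridge `twistedTorsionToH1_mem_sharpFlatLocalKummerOverOfEmb_iff`; at `∞` and at the other places above `p`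
the Kummer KERNELS of `Sel_{p^∞}(E/K_∞) ⊇ Sel^•` and of `𝓕^•_J` agree through the square `localResOver_twistedTorsionToH1` — this settles
the archimedean bookkeeping of the hand AS TYPED (`Sel^• ≤ Sel_{p^∞}(E/K_∞) = selmerGroupOver` carries `localKerOver` at every infinite
place, `SubgroupSelmer.lean`); nothing at `S₀`; at good `v' ∤ p` the class is UNRAMIFIED
(`res_mem_unramifiedSubgroup_of_twistedTorsionToH1_mem_localKerOver`: Kummer over `K_∞` ⟹ coboundary on `Gal(K̄/K_∞) ⊓ D_{v'}` by
`Rank1Residual.Additive.localKerOver_le_awayKer` ⟹ the cocycle VANISHES on the inertia group (`I_{K_{v'}} ≤ Gal(K̄_{v'}/(K_∞)_w)`,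
`I_{K_{v'}} ↠ I_{𝔓₀}` `inertia_adicCompletionPrime_eq_map_absInertia`, Silverman VII.4.1(a) `smul_eq_of_mem_inertia_of_nsmul_eq_zero`)
⟹ `H¹_ur` by `LocBridge.mem_unramifiedSubgroup_one_iff_exists`).

§3 (`K = ℚ`, `p = 2`, `u = −1`, the ss line). `exists_injective_torsionBy_endInvariants_to_selmerGroup`: an injection
`Sel♭_∞[γ+1][2^J] ↪ H¹_{𝓕♭_J,S₀}(ℚ, E[2^J](ψ₂))` on the habitat `GoodSS W 2` (`W(ℚ_∞)[2^∞] = 0`,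
`SignedTransportAtTwo.fixedPoints_kerSubgroup_eq_bot_of_goodSS`); ★ `HT3_finite_endInvariants_of_uniform_bound` — the hand:
`∃ C, ∀ J, #H¹_{𝓕♭_J,S₀} ≤ C` ⟹ `Finite (endInvariants (conjSharpFlatSelmerInfty W κ (closureEmb ℚ_v) (W.frobeniusTrace 2) g c .flat γ + 1))`
(`#Sel♭_∞[γ+1][2^J] ≤ C` for all `J`; `2`-primary ⟹ finite, `SignedEC.H1SigmaCorank.finite_of_natCard_torsionBy_pow_le`).

References: [GreenbergLNM1716] §2 Prop. 2.1 (p. 72), §4 pp. 107, 122–124; [Sprung2012] Def. 7.9, Def. 7.11 (p. 1503);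
[SerreGaloisCohomology1997] I §2.6 (b); [SilvermanAEC2009] Prop. VII.4.1(a); [MilneADT2006] I §2.
-/

set_option autoImplicit false
set_option linter.dupNamespace false

noncomputable section

open scoped Classical NumberField AddSubgroup

namespace Summit.BirchSwinnertonDyer.BirchSwinnertonDyer.Theorems

namespace OddBlindTwist

open NumberField IsDedekindDomain Field WeierstrassCurve Literature.NumberTheory.EllipticCurves
  Literature.NumberTheory.EllipticCurves.IwasawaDual Literature.NumberTheory.GaloisRepresentations
  Literature.NumberTheory.GaloisCohomology ZpExtension Literature.NumberTheory.EllipticCurves.Kobayashi2003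
  Literature.NumberTheory.EllipticCurves.Sprung2017 Literature.NumberTheory.EllipticCurves.Sprung2012
  Literature.NumberTheory.EllipticCurves.Rank1Residual CategoryTheory ContinuousCohomology
open Literature.NumberTheory.GaloisRepresentations.DiscreteGaloisModule (unramifiedSubgroup SelmerStructure)

/-! ## §2 The local conditions of the lift: a class of `Sel^•(E/K_∞)` restricted from `H¹(Γ_K, E[p^J](χ_u))` comes from
`H¹_{𝓕^•_J,S₀}(K, E[p^J](χ_u))` -/

section Local

open Literature.NumberTheory.GaloisRepresentations.IsNonarchimedeanLocalField
  Literature.NumberTheory.EllipticCurves.GreenbergSelmer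

variable {K : Type} [Field K] [NumberField K] (W : WeierstrassCurve K) [W.IsElliptic] (p : ℕ) [Fact p.Prime]
  (κ : ZpExtension K p) (J : ℕ) (u : ℤ) (hu : (p : ℤ) ∣ u - 1)

/-- **Kummer over `K_∞` at a good `v ∤ p` ⟹ unramified at level `K`.** If the twisted restriction
`c′ = twistedTorsionToH1 x ∈ H¹(K_∞, E[p^∞])` of `x ∈ H¹(Γ_K, E[p^J](χ_u))` satisfies the classical (Kummer-kernel) local
condition at the chosen place of `K_∞` above a place `v ∤ p` of GOOD reduction, then `loc_v x ∈ H¹_ur(K_v, E[p^J](χ_u))`: by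
`Rank1Residual.Additive.localKerOver_le_awayKer` (Greenberg's `Im κ_η = 0` at `η ∤ p`, any `ℤ_p`-extension) the cocycle of
`c′` is the coboundary of some `a ∈ E[p^∞]` on `Gal(K̄/K_∞) ⊓ D_v`; the inertia group `I_{K_v}` maps into
`Gal(K̄/K_∞)` (`ℤ_p`-extensions are unramified at `v ∤ p`, `absInertia_le_localSubgroup_kerSubgroup`) and onto `I_{𝔓₀}`
(`inertia_adicCompletionPrime_eq_map_absInertia`), which fixes `a` (Silverman VII.4.1(a), `smul_eq_of_mem_inertia_of_nsmul_eq_zero`);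
so the cocycle of `x` VANISHES on `I_{K_v}`, hence is unramified (`LocBridge.mem_unramifiedSubgroup_one_iff_exists`).
[cite: GreenbergLNM1716, §2 Prop. 2.1 (p. 72), §4 p. 124] [cite: SilvermanAEC2009, Prop. VII.4.1(a)] -/
theorem res_mem_unramifiedSubgroup_of_twistedTorsionToH1_mem_localKerOver {v : HeightOneSpectrum (𝓞 K)}
    (hv : W.HasGoodReductionAt v) (hpv : ((p : ℕ) : 𝓞 K) ∉ v.asIdeal)
    (x : galoisCohomology (W.twistedTorsionGaloisModule p κ J u hu) 1)
    (hx : W.twistedTorsionToH1 p κ J u hu x ∈ W.localKerOver p κ.kerSubgroup (v.adicCompletion K)) :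
    galoisCohomology.res (W.twistedTorsionGaloisModule p κ J u hu) (v.adicCompletion K) 1 x ∈
      DiscreteGaloisModule.unramifiedSubgroup
        ((W.twistedTorsionGaloisModule p κ J u hu).restrictField (v.adicCompletion K)) 1 := by
  obtain ⟨ξ, rfl⟩ := oneCocycleClass_surjective _ x
  -- Kummer over `K_∞` ⟹ the cocycle of `c′` is a coboundary on `Gal(K̄/K_∞) ⊓ D_v`
  have haway := Summit.BirchSwinnertonDyer.Rank1Residual.Additive.localKerOver_le_awayKer
    (κ := κ) (v := v) (W := W) (p := p) hpv hx
  rw [awayKer, AddMonoidHom.mem_ker, twistedTorsionToH1_oneCocycleClass,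
    Literature.NumberTheory.EllipticCurves.resOfLe_oneCocycleClass_eq_zero_iff κ.kerSubgroup] at haway
  obtain ⟨a, ha⟩ := haway
  rw [galoisCohomology.res_oneCocycleClass]
  refine (Summit.BirchSwinnertonDyer.Rank1Residual.X11b.LocBridge.mem_unramifiedSubgroup_one_iff_exists _ _).mpr
    ⟨0, fun τ hτ ↦ ?_⟩
  rw [map_zero, sub_zero, galoisCohomology.pullback_absGaloisRestrict_apply]
  -- `res τ ∈ Gal(K̄/K_∞) ⊓ D_v`, and `res τ ∈ I_{𝔓₀}`
  have hτker : absGaloisRestrict K (v.adicCompletion K) τ ∈ κ.kerSubgroup :=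
    (mem_localSubgroup_iff κ.kerSubgroup (v.adicCompletion K) τ).1
      (Summit.BirchSwinnertonDyer.Rank1Residual.Additive.absInertia_le_localSubgroup_kerSubgroup
        (K := K) (p := p) (v := v) κ hpv hτ)
  have hτD : absGaloisRestrict K (v.adicCompletion K) τ ∈ decomp v := (mem_decomp_iff v _).2 ⟨τ, rfl⟩
  have hτI : absGaloisRestrict K (v.adicCompletion K) τ ∈ (adicCompletionPrime K v).inertia (absoluteGaloisGroup K) := by
    rw [inertia_adicCompletionPrime_eq_map_absInertia]
    exact Subgroup.mem_map.2 ⟨τ, hτ, rfl⟩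
  -- `a ∈ E[p^∞]` is fixed by the inertia group (good reduction, `v ∤ p`)
  obtain ⟨k, hk⟩ := (AddCommGroup.mem_primaryComponent).1 a.2
  have hfix : absGaloisRestrict K (v.adicCompletion K) τ • a = a := Subtype.ext (by
    rw [primaryComponent.coe_smul]
    exact W.smul_eq_of_mem_inertia_of_nsmul_eq_zero hv (n := p ^ k) (v.natCast_pow_not_mem hpv k)
      (adicCompletionPrime_mem_primesAbove K v) hτI hk)
  have h1 := ha ⟨absGaloisRestrict K (v.adicCompletion K) τ, Subgroup.mem_inf.2 ⟨hτker, hτD⟩⟩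
  rw [hfix, sub_self, contOneCocycles.push_apply, ZpExtension.pullback_galoisTwistResHom_apply] at h1
  change AddSubgroup.inclusion (Literature.Barriers.BirchSwinnertonDyer.geomTorsion_pow_le_geomPrimaryTorsion W p J)
    (ξ.1 (absGaloisRestrict K (v.adicCompletion K) τ)) = 0 at h1
  exact (map_eq_zero_iff _ (AddSubgroup.inclusion_injective _)).1 h1

variable (S₀ : Finset (HeightOneSpectrum (𝓞 K))) (v : HeightOneSpectrum (𝓞 K)) (ap : ℤ)
  (g : absoluteGaloisGroup (v.adicCompletion K)) (c : ℕ → localPoints W (v.adicCompletion K)) (col : Chroma)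

/-- **The local conditions of the lift.** Let `v ∋ p`, `v ∉ S₀`, good reduction outside `S₀ ∪ {v ∣ p}`. If the twisted
restriction `c′ = twistedTorsionToH1 x` of `x ∈ H¹(Γ_K, E[p^J](χ_u))` lies in Sprung's `Sel^•(E/K_∞)` (Def. 7.11, for the data
`(E((K_∞)_w), Ker Col^•)` at the chosen place above `v`), then `x ∈ H¹_{𝓕^•_J,S₀}(K, E[p^J](χ_u))`
(`twistedSharpFlatSelmerStructure`): at `v` the •-condition is the (D) bridge `twistedTorsionToH1_mem_sharpFlatLocalKummerOverOfEmb_iff`;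
at the infinite places and at the other places above `p` the Kummer KERNEL conditions of `Sel_{p^∞}(E/K_∞) ⊇ Sel^•` and of `𝓕^•_J` agree
through the square `localResOver_twistedTorsionToH1`; at `S₀` there is no condition; at the good places `v' ∤ p` outside `S₀`,
`res_mem_unramifiedSubgroup_of_twistedTorsionToH1_mem_localKerOver`. [cite: Sprung2012, Def. 7.9 and Def. 7.11 (p. 1503)]
[cite: GreenbergLNM1716, §4 pp. 122–124] -/
theorem mem_selmerGroup_sharpFlat_of_twistedTorsionToH1_mem (hvS : v ∉ S₀) (hpv : ((p : ℕ) : 𝓞 K) ∈ v.asIdeal)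
    (hbad : ∀ v' : HeightOneSpectrum (𝓞 K), v' ∉ S₀ → ((p : ℕ) : 𝓞 K) ∉ v'.asIdeal → W.HasGoodReductionAt v')
    (x : galoisCohomology (W.twistedTorsionGaloisModule p κ J u hu) 1)
    (hx : W.twistedTorsionToH1 p κ J u hu x ∈
      sharpFlatSelmerInfty W κ (closureEmb (K := K) (v.adicCompletion K)) ap g c col) :
    x ∈ (W.twistedSharpFlatSelmerStructure p S₀ κ J u hu v
      (localTowerPointsOfEmb κ (closureEmb (K := K) (v.adicCompletion K)) W)
      (colemanKer κ (closureEmb (K := K) (v.adicCompletion K)) W ap g c col)).selmerGroup := by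
  have hx' := (mem_sharpFlatSelmerInfty_iff W κ _ ap g c col _).1 hx
  have hsel := (W.mem_selmerGroupOver_iff p κ.kerSubgroup _).1 hx'.1
  have hone : W.conjH1 p κ.kerSubgroup 1 = AddMonoidHom.id _ := W.conjH1_one_holds p κ.kerSubgroup
  rw [SelmerStructure.mem_selmerGroup_iff]
  intro w
  rcases w with w | v'
  · -- infinite place: Kummer kernel on both sides
    change galoisCohomology.res (W.twistedTorsionGaloisModule p κ J u hu) w.Completion 1 x ∈
      (W.twistedTorsionToLocalH1 p κ J u hu w.Completion).ker
    rw [AddMonoidHom.mem_ker, ← localResOver_twistedTorsionToH1, ← WeierstrassCurve.mem_localKerOver_iff]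
    have h := hsel.2 w 1
    rwa [hone, AddMonoidHom.id_apply] at h
  · -- the Kummer-kernel condition of `Sel_{p^∞}(E/K_∞)` at the chosen place above `v'`, read on `x`
    have hker : W.twistedTorsionToLocalH1 p κ J u hu (v'.adicCompletion K)
        (galoisCohomology.res (W.twistedTorsionGaloisModule p κ J u hu) (v'.adicCompletion K) 1 x) = 0 := by
      rw [← localResOver_twistedTorsionToH1, ← WeierstrassCurve.mem_localKerOver_iff]
      have h := hsel.1 v' 1
      rwa [hone, AddMonoidHom.id_apply] at h
    by_cases hS : v' ∈ S₀
    · rw [twistedSharpFlatSelmerStructure, W.twistedSelmerStructureOfLocal_inr_of_mem p S₀ κ J u hu _ hS]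
      exact AddSubgroup.mem_top _
    · by_cases hpv' : ((p : ℕ) : 𝓞 K) ∈ v'.asIdeal
      · by_cases hvv : v' = v
        · subst hvv
          -- the distinguished place: Sprung's condition, by the (D) bridge
          have h := hx'.2 1
          rw [hone, AddMonoidHom.id_apply, twistedTorsionToH1_mem_sharpFlatLocalKummerOverOfEmb_iff] at h
          rw [W.twistedSharpFlatSelmerStructure_inr_self p S₀ κ J u hu v' _ _ hvS hpv']
          exact h
        · rw [W.twistedSharpFlatSelmerStructure_inr_of_ne p S₀ κ J u hu v _ _ hvv hS hpv']
          exact hker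
      · rw [twistedSharpFlatSelmerStructure, W.twistedSelmerStructureOfLocal_inr_of_not_mem p S₀ κ J u hu _ hS hpv']
        have h := hsel.1 v' 1
        rw [hone, AddMonoidHom.id_apply] at h
        exact res_mem_unramifiedSubgroup_of_twistedTorsionToH1_mem_localKerOver W p κ J u hu (hbad v' hS hpv') hpv' x h

end Local

/-! ## §3 The ss line at `p = 2`, `u = −1` (`ψ₂`): HT-3, the LIFT `#Sel♭_∞[γ+1][2^J] ≤ #H¹_{𝓕♭_J,S₀}` and finiteness -/

section Two

variable (W : WeierstrassCurve ℚ) [W.IsElliptic] [W.IsGloballyMinimal]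

/-- **The LIFT at level `J` (injection `Sel♭_∞[γ+1][2^J] ↪ H¹_{𝓕♭_J,S₀}(ℚ, E[2^J](ψ₂))`).** On the habitat `GoodSS W 2`
(`W(ℚ_∞)[2^∞] = 0`, `SignedTransportAtTwo.fixedPoints_kerSubgroup_eq_bot_of_goodSS`), for `κ` a `ℤ₂`-extension with topological
generator `γ`, `v ∋ 2` outside `S₀`, good reduction outside `S₀ ∪ {2}`, Sprung's data `(a₂, g, c)`, colour ♭: every element of
`Sel♭(E/ℚ_∞)[γ+1]` killed by `2^J` is `twistedTorsionToH1 x` for SOME `x ∈ H¹_{𝓕♭_J,S₀}(ℚ, E[2^J](ψ₂))` (§1 onto-ness + §2 local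
conditions); since `twistedTorsionToH1 x` recovers the class, any such choice `t ↦ x` is injective. Hence
`#Sel♭_∞[γ+1][2^J] ≤ #H¹_{𝓕♭_J,S₀}` (the latter finite, `finite_selmerGroup_ofLocal`). [cite: GreenbergLNM1716, §4 pp. 107, 122–124]
[cite: Sprung2012, Def. 7.11 (p. 1503)] -/
theorem exists_injective_torsionBy_endInvariants_to_selmerGroup (hss : GoodSS W 2) (κ : ZpExtension ℚ 2)
    {γ : absoluteGaloisGroup ℚ} (hγ : κ.IsTopGenerator γ) (v : HeightOneSpectrum (𝓞 ℚ)) (hv : (2 : 𝓞 ℚ) ∈ v.asIdeal)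
    (g : absoluteGaloisGroup (v.adicCompletion ℚ)) (c : ℕ → localPoints W (v.adicCompletion ℚ))
    (S₀ : Finset (HeightOneSpectrum (𝓞 ℚ))) (hvS : v ∉ S₀)
    (hbad : ∀ v' : HeightOneSpectrum (𝓞 ℚ), v' ∉ S₀ → (2 : 𝓞 ℚ) ∉ v'.asIdeal → W.HasGoodReductionAt v')
    (hu : ((2 : ℕ) : ℤ) ∣ (-1 : ℤ) - 1) (J : ℕ) :
    ∃ F : (endInvariants (conjSharpFlatSelmerInfty W κ (closureEmb (K := ℚ) (v.adicCompletion ℚ))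
        (W.frobeniusTrace 2) g c .flat γ + 1))[((2 ^ J : ℕ) : ℤ)] →
      (W.twistedSharpFlatSelmerStructure 2 S₀ κ J (-1) hu v
          (localTowerPointsOfEmb κ (closureEmb (K := ℚ) (v.adicCompletion ℚ)) W)
          (colemanKer κ (closureEmb (K := ℚ) (v.adicCompletion ℚ)) W (W.frobeniusTrace 2) g c .flat)).selmerGroup,
      Function.Injective F ∧
        ∀ t, W.twistedTorsionToH1 2 κ J (-1) hu (F t) =
          (((t : endInvariants (conjSharpFlatSelmerInfty W κ (closureEmb (K := ℚ) (v.adicCompletion ℚ))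
            (W.frobeniusTrace 2) g c .flat γ + 1)) : sharpFlatSelmerInfty W κ (closureEmb (K := ℚ) (v.adicCompletion ℚ))
              (W.frobeniusTrace 2) g c .flat) : W.subgroupH1 2 κ.kerSubgroup) := by
  have hpv : (((2 : ℕ) : ℕ) : 𝓞 ℚ) ∈ v.asIdeal := by exact_mod_cast hv
  have hbad' : ∀ v' : HeightOneSpectrum (𝓞 ℚ), v' ∉ S₀ → (((2 : ℕ) : ℕ) : 𝓞 ℚ) ∉ v'.asIdeal →
      W.HasGoodReductionAt v' := fun v' hv'S hpv' ↦ hbad v' hv'S (by exact_mod_cast hpv')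
  have hfix := SignedTransportAtTwo.fixedPoints_kerSubgroup_eq_bot_of_goodSS W hss κ
  -- the class `s` underlying `t`, killed by `2^J`, with `(−1) · conj_γ s = s`
  have hsJ : ∀ t : (endInvariants (conjSharpFlatSelmerInfty W κ (closureEmb (K := ℚ) (v.adicCompletion ℚ))
      (W.frobeniusTrace 2) g c .flat γ + 1))[((2 ^ J : ℕ) : ℤ)],
      2 ^ J • (((t : endInvariants (conjSharpFlatSelmerInfty W κ (closureEmb (K := ℚ) (v.adicCompletion ℚ))
        (W.frobeniusTrace 2) g c .flat γ + 1)) : sharpFlatSelmerInfty W κ (closureEmb (K := ℚ) (v.adicCompletion ℚ))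
          (W.frobeniusTrace 2) g c .flat) : W.subgroupH1 2 κ.kerSubgroup) = 0 := fun t ↦ by
    have h := AddSubgroup.torsionBy.nsmul t
    have h' := congrArg (fun y : (endInvariants (conjSharpFlatSelmerInfty W κ (closureEmb (K := ℚ) (v.adicCompletion ℚ))
        (W.frobeniusTrace 2) g c .flat γ + 1))[((2 ^ J : ℕ) : ℤ)] ↦ (((y : endInvariants (conjSharpFlatSelmerInfty W κ
          (closureEmb (K := ℚ) (v.adicCompletion ℚ)) (W.frobeniusTrace 2) g c .flat γ + 1)) : sharpFlatSelmerInfty W κ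
            (closureEmb (K := ℚ) (v.adicCompletion ℚ)) (W.frobeniusTrace 2) g c .flat) : W.subgroupH1 2 κ.kerSubgroup)) h
    simpa only [AddSubgroupClass.coe_nsmul, ZeroMemClass.coe_zero] using h'
  have hsγ : ∀ t : (endInvariants (conjSharpFlatSelmerInfty W κ (closureEmb (K := ℚ) (v.adicCompletion ℚ))
      (W.frobeniusTrace 2) g c .flat γ + 1))[((2 ^ J : ℕ) : ℤ)],
      (-1 : ℤ) • W.conjH1 2 κ.kerSubgroup γ (((t : endInvariants (conjSharpFlatSelmerInfty W κ
        (closureEmb (K := ℚ) (v.adicCompletion ℚ)) (W.frobeniusTrace 2) g c .flat γ + 1)) :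
          sharpFlatSelmerInfty W κ (closureEmb (K := ℚ) (v.adicCompletion ℚ)) (W.frobeniusTrace 2) g c .flat) :
            W.subgroupH1 2 κ.kerSubgroup) =
        (((t : endInvariants (conjSharpFlatSelmerInfty W κ (closureEmb (K := ℚ) (v.adicCompletion ℚ))
          (W.frobeniusTrace 2) g c .flat γ + 1)) : sharpFlatSelmerInfty W κ (closureEmb (K := ℚ) (v.adicCompletion ℚ))
            (W.frobeniusTrace 2) g c .flat) : W.subgroupH1 2 κ.kerSubgroup) := fun t ↦ by
    have h := (mem_endInvariants_iff _ _).1 (t : endInvariants (conjSharpFlatSelmerInfty W κ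
      (closureEmb (K := ℚ) (v.adicCompletion ℚ)) (W.frobeniusTrace 2) g c .flat γ + 1)).2
    have h' := congrArg (fun y : sharpFlatSelmerInfty W κ (closureEmb (K := ℚ) (v.adicCompletion ℚ))
        (W.frobeniusTrace 2) g c .flat ↦ (y : W.subgroupH1 2 κ.kerSubgroup)) h
    change W.conjH1 2 κ.kerSubgroup γ _ + _ = (0 : W.subgroupH1 2 κ.kerSubgroup) at h'
    rw [neg_one_zsmul, neg_eq_iff_eq_neg]
    exact eq_neg_of_add_eq_zero_left h'
  -- choose a lift for every `t`
  choose x hx using fun t : (endInvariants (conjSharpFlatSelmerInfty W κ (closureEmb (K := ℚ) (v.adicCompletion ℚ))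
      (W.frobeniusTrace 2) g c .flat γ + 1))[((2 ^ J : ℕ) : ℤ)] ↦
    exists_twistedTorsionToH1_eq_of_zsmul_conjH1_eq W 2 κ J (-1) hu hfix hγ _ (hsJ t) (hsγ t)
  have hxmem : ∀ t, x t ∈ (W.twistedSharpFlatSelmerStructure 2 S₀ κ J (-1) hu v
      (localTowerPointsOfEmb κ (closureEmb (K := ℚ) (v.adicCompletion ℚ)) W)
      (colemanKer κ (closureEmb (K := ℚ) (v.adicCompletion ℚ)) W (W.frobeniusTrace 2) g c .flat)).selmerGroup := fun t ↦
    mem_selmerGroup_sharpFlat_of_twistedTorsionToH1_mem W 2 κ J (-1) hu S₀ v (W.frobeniusTrace 2) g c .flat hvS hpv hbad'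
      (x t) (by rw [hx t]; exact (t : endInvariants (conjSharpFlatSelmerInfty W κ (closureEmb (K := ℚ) (v.adicCompletion ℚ))
        (W.frobeniusTrace 2) g c .flat γ + 1)).1.2)
  refine ⟨fun t ↦ ⟨x t, hxmem t⟩, fun t₁ t₂ h ↦ ?_, fun t ↦ hx t⟩
  have h' : x t₁ = x t₂ := congrArg Subtype.val h
  have h'' := hx t₁
  rw [h', hx t₂] at h''
  exact Subtype.ext (Subtype.ext (Subtype.ext h''.symm))

/-- ★ **HT-3 (LIFT ⇒ FINITE) for CDF_glob** — hand h2 of LEAD ss-1 GEN 19 (`HOME/ss/gen19/HAND-TARGETS-CDFglob.md` §2), signature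
VERBATIM. `W/ℚ` good supersingular at `2`, `κ` the cyclotomic `ℤ₂`-extension with topological generator `γ`, `v ∋ 2`, Sprung's local data
`(a₂ = W.frobeniusTrace 2, g, c)`, colour ♭, `S₀ ∌ v` finite with good reduction outside `S₀ ∪ {2}`. IF the level-`J` ♭-twisted Selmer
groups `H¹_{𝓕♭_J,S₀}(ℚ, E[2^J](ψ₂))` (`twistedSharpFlatSelmerStructure 2 S₀ κ J (−1) _ v (E(ℚ_{∞,v})) (Ker Col♭)`) are bounded uniformly
in `J`, THEN `Sel♭(E/ℚ_∞)[γ+1] = endInvariants (conjSharpFlatSelmerInfty … .flat γ + 1)` is FINITE: by the LIFT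
(`exists_injective_torsionBy_endInvariants_to_selmerGroup`) `#Sel♭_∞[γ+1][2^J] ≤ #H¹_{𝓕♭_J,S₀} ≤ C` for every `J`, and a `2`-primary group
(`exists_pow_smul_subgroupH1_ker_eq_zero`) with bounded `2^J`-torsion is finite (`SignedEC.H1SigmaCorank.finite_of_natCard_torsionBy_pow_le`).
The converse direction of BRICK 1 (`exists_addMonoidHom_flatTwistedInfRes_two`). The archimedean condition is the one AS TYPED: `Sel♭ ≤
Sel_{2^∞}(E/ℚ_∞)` carries the Kummer KERNEL at every real place, which is `𝓕♭_J`'s condition at `∞` through `localResOver_twistedTorsionToH1`.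
HONEST FRAMING: a helper (`--supports` 19097); it does not prove CDF_glob, CDF±, CDC or the crux; the binder `hκ` is carried for the hand's
signature (the proof uses only that `κ` is a `ℤ₂`-extension); BSD is proved for no curve. [cite: GreenbergLNM1716, §4 pp. 107, 122–124]
[cite: Sprung2012, Def. 7.9 and Def. 7.11 (p. 1503)] [cite: SerreGaloisCohomology1997, I §2.6 (b)] -/
theorem HT3_finite_endInvariants_of_uniform_bound (hss : GoodSS W 2)
    {κ : ZpExtension ℚ 2} (hκ : κ.IsCyclotomic) {γ : absoluteGaloisGroup ℚ} (hγ : κ.IsTopGenerator γ)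
    (v : HeightOneSpectrum (𝓞 ℚ)) (hv : (2 : 𝓞 ℚ) ∈ v.asIdeal)
    (g : absoluteGaloisGroup (v.adicCompletion ℚ)) (c : ℕ → localPoints W (v.adicCompletion ℚ))
    (S₀ : Finset (HeightOneSpectrum (𝓞 ℚ))) (hvS : v ∉ S₀)
    (hbad : ∀ v' : HeightOneSpectrum (𝓞 ℚ), v' ∉ S₀ → (2 : 𝓞 ℚ) ∉ v'.asIdeal → W.HasGoodReductionAt v')
    (hbound : ∃ C : ℕ, ∀ J : ℕ,
      Nat.card (W.twistedSharpFlatSelmerStructure 2 S₀ κ J (-1) two_dvd_neg_one_sub_one v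
          (localTowerPointsOfEmb κ (closureEmb (K := ℚ) (v.adicCompletion ℚ)) W)
          (colemanKer κ (closureEmb (K := ℚ) (v.adicCompletion ℚ)) W (W.frobeniusTrace 2) g c .flat)).selmerGroup ≤ C) :
    Finite (endInvariants (conjSharpFlatSelmerInfty W κ (closureEmb (K := ℚ) (v.adicCompletion ℚ))
      (W.frobeniusTrace 2) g c .flat γ + 1)) := by
  have _hκ := hκ -- carried for the hand's signature only: the proof uses just that `κ` is a `ℤ₂`-extension
  obtain ⟨C, hC⟩ := hbound
  have hbad' : ∀ v' : HeightOneSpectrum (𝓞 ℚ), v' ∉ S₀ → (((2 : ℕ) : ℕ) : 𝓞 ℚ) ∉ v'.asIdeal →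
      W.HasGoodReductionAt v' := fun v' hv'S hpv' ↦ hbad v' hv'S (by exact_mod_cast hpv')
  -- the level-`J` groups are finite
  have hfin : ∀ J : ℕ, Finite (W.twistedSharpFlatSelmerStructure 2 S₀ κ J (-1) two_dvd_neg_one_sub_one v
      (localTowerPointsOfEmb κ (closureEmb (K := ℚ) (v.adicCompletion ℚ)) W)
      (colemanKer κ (closureEmb (K := ℚ) (v.adicCompletion ℚ)) W (W.frobeniusTrace 2) g c .flat)).selmerGroup := fun J ↦
    finite_selmerGroup_ofLocal W 2 S₀ κ J (-1) two_dvd_neg_one_sub_one hbad' _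
  -- the LIFT: `#Sel♭_∞[γ+1][2^J] ≤ C` and `Sel♭_∞[γ+1][2^J]` finite
  have hle : ∀ J : ℕ, Nat.card ((endInvariants (conjSharpFlatSelmerInfty W κ (closureEmb (K := ℚ) (v.adicCompletion ℚ))
      (W.frobeniusTrace 2) g c .flat γ + 1))[((2 ^ J : ℕ) : ℤ)]) ≤ C ∧
      Finite ((endInvariants (conjSharpFlatSelmerInfty W κ (closureEmb (K := ℚ) (v.adicCompletion ℚ))
        (W.frobeniusTrace 2) g c .flat γ + 1))[((2 ^ J : ℕ) : ℤ)]) := fun J ↦ by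
    obtain ⟨F, hF, -⟩ := exists_injective_torsionBy_endInvariants_to_selmerGroup W hss κ hγ v hv g c S₀ hvS hbad
      two_dvd_neg_one_sub_one J
    haveI := hfin J
    exact ⟨(Nat.card_le_card_of_injective F hF).trans (hC J), Finite.of_injective F hF⟩
  -- `Sel♭_∞[γ+1]` is `2`-primary with `Sel♭_∞[γ+1][2]` finite and bounded `2^J`-torsion: finite
  haveI : Finite ((endInvariants (conjSharpFlatSelmerInfty W κ (closureEmb (K := ℚ) (v.adicCompletion ℚ))
      (W.frobeniusTrace 2) g c .flat γ + 1))[(2 : ℤ)]) := by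
    have h := (hle 1).2
    rwa [pow_one, Nat.cast_ofNat] at h
  refine SignedEC.H1SigmaCorank.finite_of_natCard_torsionBy_pow_le (p := 2) (fun a ↦ ?_) (fun k ↦ (hle k).1)
  obtain ⟨k, hk⟩ := W.exists_pow_smul_subgroupH1_ker_eq_zero κ
    (((a : endInvariants (conjSharpFlatSelmerInfty W κ (closureEmb (K := ℚ) (v.adicCompletion ℚ))
      (W.frobeniusTrace 2) g c .flat γ + 1)) : sharpFlatSelmerInfty W κ (closureEmb (K := ℚ) (v.adicCompletion ℚ))
        (W.frobeniusTrace 2) g c .flat) : W.subgroupH1 2 κ.kerSubgroup)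
  refine ⟨k, Subtype.ext (Subtype.ext ?_)⟩
  rw [AddSubgroupClass.coe_nsmul, AddSubgroupClass.coe_nsmul]
  exact hk

end Two

end OddBlindTwist

end Summit.BirchSwinnertonDyer.BirchSwinnertonDyer.Theorems

end
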